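import Literature.MathematicalPhysics.QuantumLattice.HeisenbergOrderDLSInfrared
import Literature.MathematicalPhysics.QuantumLattice.HeisenbergOrderNeelProofs
import Literature.MathematicalPhysics.QuantumLattice.LatticeToriLROProofs
import HarnessLib

/-!
# Dyson–Lieb–Simon: Néel order of the Heisenberg antiferromagnet in `d ≥ 3` for spin `S ≥ 1`
# at low temperature — proof of `dyson_lieb_simon`

Sibling proof file of `HeisenbergOrder.lean` (item `provefact … dyson_lieb_simon`). No statement
is introduced or changed; this file **discharges the named fact**
`dyson_lieb_simon_holds : dyson_lieb_simon` ([DLS1978] Thm. 6.2: "The nearest neighbor, simple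
cubic antiferromagnet has a phase transition at sufficiently low temperature if `ν ≥ 3`,
`S = 1, 3/2, …`"; Tasaki (2020) §4.4), in the finite-volume two-point form vendored there:
for `d ≥ 3`, `S = n/2 ≥ 1`, `J > 0` there is `β₀` with
`liminf_k |Λ|⁻² Σ_{x,y}(-1)^{x+y}⟨𝐒_x·𝐒_y⟩_{β,2k} > 0` for all `β ≥ β₀`.

## Part 1 — the sublattice rotation and the symmetries of the antiferromagnet

The dictionary between the antiferromagnet `H = J Σ_{⟨xy⟩} 𝐒_x·𝐒_y` on the even torus
(`heisenbergTorus d (2k) n J`) and the rotated operator `X = Σ_{⟨xy⟩}(-S¹S¹ + S²S² - S³S³)`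
(`dlsHamiltonian`) of the infrared-bound files:

* **the sublattice rotation** ([DLS1978] proof of Thm. 6.1, "rotations by `π` about the y axis
  for `|α|` odd"; [KLS1988JSP] eqs. (15)–(16)): a product unitary `W` with `W H Wᴴ = J·X`,
  `W S¹_x Wᴴ = (-1)^x S¹_x`, `W S²_x Wᴴ = S²_x`, `W S³_x Wᴴ = (-1)^x S³_x`
  (`exists_sublatticeRotation`), whence `⟨S¹_xS¹_y⟩_{βJ,X} = (-1)^{x+y} ⟨S¹_xS¹_y⟩_{β,H}` etc.
  (`gibbsSpinCorr_dls_zero_eq`, `_one_eq`, `_two_eq`; `Matrix.gibbsState_conjTranspose_mul_mul`,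
  `Matrix.gibbsState_ofReal_smul`);
* **`SU(2)` symmetry of the antiferromagnet**: the global quarter turn about the `3`-axis and the
  global rotation `S³ ↦ S¹` commute with `H` (`quarterTurn_conj_heisenbergHamiltonian`,
  `yTurn_conj_heisenbergHamiltonian` of `HeisenbergOrderNeelProofs.lean`), so
  `⟨S²_xS²_y⟩ = ⟨S¹_xS¹_y⟩ = ⟨S³_xS³_y⟩` in its Gibbs state ([DLS1978] §6, "By symmetry";
  `gibbsSpinCorr_heisenberg_one`, `gibbsSpinCorr_heisenberg_two`);
* consequences: the bond correlations of `X` are `e₀ = ε`, `e₁ = -ε`, `e₂ = ε` with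
  `ε = -(bond average of ⟨S¹_xS¹_y⟩_{β,H})` (`gibbsBondCorr_dls_eq`), and the Néel order parameter
  is `Σ_{x,y}(-1)^{x+y}⟨𝐒_x·𝐒_y⟩_{β,H} = 3 Σ_{x,y} ⟨S¹_xS¹_y⟩_{βJ,X}`
  (`staggeredSum_spinSpinCorrTorus_eq`);
* **the energy bound** ([DLS1978] §6 with the Néel trial state of [KLS1988JSP] after eq. (4),
  through the energy–entropy bound `⟨X⟩_β ≤ ⟨0|X|0⟩ + log(dim)/β`):
  `e₀ - e₁ + e₂ ≥ S² - log(n+1)/(dβ)` (`dls_bondCorr_energy_bound`).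

## Part 2 — the argument ([DLS1978] §§3–6 in the Kennedy–Lieb–Shastry arrangement [KLS1988JSP] (1)–(4))

Everything is carried out on the finite even tori `(ℤ/2kℤ)^d` in the *rotated frame*
`X = Σ_{⟨xy⟩}(-S¹S¹ + S²S² - S³S³)` (`dlsHamiltonian`; the antiferromagnet `J Σ 𝐒_x·𝐒_y` is
`Wᴴ(J·X)W` for the sublattice rotation `W`, `exists_sublatticeRotation`), at inverse temperature
`βJ`:

* (IR) `dls_infraredBound` (`HeisenbergOrderDLSInfrared.lean`): reflection positivity ⇒ thermal
  Gaussian domination (`dls_partitionFn_field_le`, via the Dyson–Lieb–Simon trace inequality) ⇒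
  Duhamel bound ⇒ Falk–Bruch transfer:
  `ĝ_q ≤ 1/(2βJE_q) + ½[(e₃ - e₂)(Σᵢ(1 + cos qᵢ))/E_q]^{1/2}` for `q ≠ 0`;
* (SR) the sum rule `|Λ|⁻¹Σ_q ĝ_q (d⁻¹Σᵢ cos qᵢ) = e₁` (`gibbsStructureFactor_sumRule`);
* (SYM) `e₁ = ε`, `e₂ = -ε`, `e₃ = ε`, `ε = -⟨S¹_0S¹_{e}⟩_{β,H}` (`gibbsBondCorr_dls_eq`, the
  `SU(2)` symmetry of the antiferromagnet and the dictionary of the rotation);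
* (EN) `3ε ≥ S² - log(n+1)/(dβJ)` (`dls_bondCorr_energy_bound`, the Néel trial state and the
  energy–entropy bound);
* (KLS) splitting (SR) at `q = 0` and inserting (IR) on `{d⁻¹Σcos qᵢ > 0}`:
  `ε ≤ |Λ|⁻¹ĝ₀ + ½√(2ε) R_L + T_L/(2βJ)` (`dls_ineq`) with the punctured Riemann sum `R_L` of
  the KLS integrand (`klsRiemannSum`, eventually `< 1/√2`, `klsRiemannSum_eventually_le`) and
  `T_L = |Λ|⁻¹Σ_{q≠0}E_q⁻¹` (`torusGreen 0`, bounded for `d ≥ 3`, `torusGreen_tendsto_latticeGreen`);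
* monotonicity of `t ↦ t - ½√(2t)R` and `S ≥ 1` leave `|Λ|⁻¹ĝ₀ ≥ m > 0` for `β ≥ β₀(d,n,J)`,
  eventually in `L = 2k`; finally `Σ_{x,y}(-1)^{x+y}⟨𝐒_x·𝐒_y⟩_{β,H} = 3Σ_{x,y}⟨S¹_xS¹_y⟩_{βJ,X}
  = 3|Λ| ĝ₀` (`staggeredSum_spinSpinCorrTorus_eq`) and the definition of
  `HasStaggeredEvenTorusLRO`.

The `d ≥ 3` restriction enters only through `T_L`; `S ≥ 1` through (EN) (`S²/3 > ¼ ≥ R²/2`).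
Trust base: Mathlib only (axioms `propext`, `Classical.choice`, `Quot.sound`).

## References

* [DLS1978] F. J. Dyson, E. H. Lieb, B. Simon, *Phase transitions in quantum spin systems with
  isotropic and nonisotropic interactions*, J. Stat. Phys. 18 (1978) 335–383, Thms. 3.1–3.2,
  4.1–4.2, 5.1, 6.1, **6.2** (read in: E. H. Lieb, *Statistical Mechanics (Selecta)*, Springer
  2004, paper IV.3, pp. 337–367).
* [KLS1988JSP] T. Kennedy, E. H. Lieb, B. S. Shastry, J. Stat. Phys. 53 (1988) 1019–1030,
  eqs. (1)–(4).
* H. Tasaki, *Physics and Mathematics of Quantum Many-Body Systems* (2020), §4.4 (`Tasaki2020`).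
-/

noncomputable section

open Filter Topology Matrix Finset
open Literature.MathematicalPhysics.QuantumLattice Literature.MathematicalPhysics.QuantumLattice.SpinOperators
  Literature.Probability.LatticeModels Literature.Barriers.AtomisticToContinuum.BoseGas
open scoped ComplexOrder

namespace Matrix

variable {m : Type*} [Fintype m] [DecidableEq m]

/-- **Coupling versus temperature**: `⟨A⟩_{β, J·H} = ⟨A⟩_{βJ, H}` (`e^{-β(JH)} = e^{-(βJ)H}`).
[folklore] -/
theorem gibbsState_ofReal_smul (β J : ℝ) (H A : Matrix m m ℂ) :
    gibbsState β ((J : ℂ) • H) A = gibbsState (β * J) H A := by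
  have hw : gibbsWeight β ((J : ℂ) • H) = gibbsWeight (β * J) H := by
    rw [gibbsWeight, gibbsWeight, smul_smul, Complex.ofReal_mul, neg_mul]
  rw [gibbsState_apply, gibbsState_apply, partitionFn, partitionFn, hw]

/-- `Z_β(J·H) = Z_{βJ}(H)`. [folklore] -/
theorem partitionFn_ofReal_smul (β J : ℝ) (H : Matrix m m ℂ) :
    partitionFn β ((J : ℂ) • H) = partitionFn (β * J) H := by
  rw [partitionFn, partitionFn, gibbsWeight, gibbsWeight, smul_smul, Complex.ofReal_mul, neg_mul]

/-- **The Gibbs state of a conjugated Hamiltonian**: for a unitary `W`,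
`⟨A⟩_{β, WᴴKW} = ⟨W A Wᴴ⟩_{β, K}` (`e^{-βWᴴKW} = Wᴴe^{-βK}W` and cyclicity of the trace).
[folklore] -/
theorem gibbsState_conjTranspose_mul_mul {W : Matrix m m ℂ} (hW : W * Wᴴ = 1) (hW' : Wᴴ * W = 1)
    (β : ℝ) (K A : Matrix m m ℂ) :
    gibbsState β (Wᴴ * K * W) A = gibbsState β K (W * A * Wᴴ) := by
  have hWu : Wᴴ ∈ unitary (Matrix m m ℂ) := by
    rw [Unitary.mem_iff, star_eq_conjTranspose, conjTranspose_conjTranspose]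
    exact ⟨hW, hW'⟩
  have hunit : IsUnit Wᴴ := ⟨Unitary.toUnits ⟨Wᴴ, hWu⟩, rfl⟩
  have hinv : Wᴴ⁻¹ = W := by
    rw [Matrix.inv_eq_right_inv hW']
  have hZ : partitionFn β (Wᴴ * K * W) = partitionFn β K := by
    have h := partitionFn_unitary_conj hWu β K
    rwa [star_eq_conjTranspose, conjTranspose_conjTranspose] at h
  have hw : gibbsWeight β (Wᴴ * K * W) = Wᴴ * gibbsWeight β K * W := by
    have h1 : Wᴴ * K * W = Wᴴ * K * Wᴴ⁻¹ := by rw [hinv]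
    rw [gibbsWeight, gibbsWeight, h1, show -(β : ℂ) • (Wᴴ * K * Wᴴ⁻¹) =
      Wᴴ * (-(β : ℂ) • K) * Wᴴ⁻¹ by rw [Matrix.mul_smul, Matrix.smul_mul],
      Matrix.exp_conj _ _ hunit, hinv]
  rw [gibbsState_apply, gibbsState_apply, hZ, hw]
  congr 1
  calc (Wᴴ * gibbsWeight β K * W * A).trace = (Wᴴ * (gibbsWeight β K * W * A)).trace := by
        simp only [Matrix.mul_assoc]
    _ = (gibbsWeight β K * W * A * Wᴴ).trace := trace_mul_comm _ _
    _ = (gibbsWeight β K * (W * A * Wᴴ)).trace := by simp only [Matrix.mul_assoc]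

end Matrix

namespace Literature.MathematicalPhysics.QuantumLattice

variable {d : ℕ}

/-! ### Global spin symmetries of the Heisenberg Gibbs state -/

section Spin

variable {Λ : Type*} [Fintype Λ] [DecidableEq Λ] (n : ℕ) (G : SimpleGraph Λ) [DecidableRel G.Adj]

/-- The bond sum form `Σ_{⟨xy⟩}(b⁰ + b¹ + b²)` of the Heisenberg Hamiltonian. [folklore] -/
theorem heisenbergHamiltonian_eq_bondSum (J : ℝ) :
    heisenbergHamiltonian n G J = (J : ℂ) • ∑ e ∈ G.edgeFinset,
      Sym2.lift ⟨fun x y => spinBond n 0 x y + spinBond n 1 x y + spinBond n 2 x y,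
        fun x y => by simp only [spinBond_comm]⟩ e := by
  rw [heisenbergHamiltonian]
  congr 1
  refine sum_congr rfl fun e _ => ?_
  induction e using Sym2.ind with
  | h x y => simp [spinDotSym, spinDot, Fin.sum_univ_three]

variable (β : ℝ)

/-- **`⟨S²_xS²_y⟩ = ⟨S¹_xS¹_y⟩` in the Gibbs state of the Heisenberg model** (invariance under the
quarter turn about the `3`-axis, `U S¹ Uᴴ = -S²`). [cite: DLS1978, §6 ("By symmetry")] -/
theorem gibbsState_heisenberg_spinOne_mul (J : ℝ) (x y : Λ) :
    gibbsState β (heisenbergHamiltonian n G J) (siteSpin n x 1 * siteSpin n y 1) =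
      gibbsState β (heisenbergHamiltonian n G J) (siteSpin n x 0 * siteSpin n y 0) := by
  set U : Op Λ (n + 1) :=
    productOp (fun _ : Λ => diagonal fun k : Fin (n + 1) => (-Complex.I) ^ (k : ℕ)) with hU
  have hUU : Uᴴ * U = 1 := productOp_conjTranspose_mul fun _ => spinPhase_conjTranspose_mul n
  have hUU' : U * Uᴴ = 1 := productOp_mul_conjTranspose fun _ => spinPhase_mul_conjTranspose n
  have hH : U * heisenbergHamiltonian n G J * Uᴴ = heisenbergHamiltonian n G J :=
    quarterTurn_conj_heisenbergHamiltonian n G J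
  have hcomm : U * heisenbergHamiltonian n G J = heisenbergHamiltonian n G J * U := by
    calc U * heisenbergHamiltonian n G J = U * heisenbergHamiltonian n G J * (Uᴴ * U) := by
          rw [hUU, Matrix.mul_one]
      _ = heisenbergHamiltonian n G J * U := by rw [← Matrix.mul_assoc, hH]
  have hinv := Matrix.gibbsState_conj_of_commute hcomm hUU β (siteSpin n x 0 * siteSpin n y 0)
  rw [productOp_conj_mul (fun _ => spinPhase_conjTranspose_mul n),
    quarterTurn_conj_siteSpin_zero, quarterTurn_conj_siteSpin_zero, neg_mul_neg] at hinv
  exact hinv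

/-- **`⟨S³_xS³_y⟩ = ⟨S¹_xS¹_y⟩` in the Gibbs state of the Heisenberg model** (invariance under the
global rotation `S³ ↦ S¹`). [cite: DLS1978, §6 ("By symmetry")] -/
theorem gibbsState_heisenberg_spinTwo_mul (J : ℝ) (x y : Λ) :
    gibbsState β (heisenbergHamiltonian n G J) (siteSpin n x 2 * siteSpin n y 2) =
      gibbsState β (heisenbergHamiltonian n G J) (siteSpin n x 0 * siteSpin n y 0) := by
  obtain ⟨V, hV, hV', hVz, hVx, hVy⟩ := exists_unitary_conj_spinZ_eq_spinX n
  set U : Op Λ (n + 1) := productOp (fun _ : Λ => V) with hU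
  have hUU : Uᴴ * U = 1 := productOp_conjTranspose_mul fun _ => hV'
  have hH : U * heisenbergHamiltonian n G J * Uᴴ = heisenbergHamiltonian n G J :=
    yTurn_conj_heisenbergHamiltonian n G J hV hV' hVz hVx hVy
  have hcomm : U * heisenbergHamiltonian n G J = heisenbergHamiltonian n G J * U := by
    calc U * heisenbergHamiltonian n G J = U * heisenbergHamiltonian n G J * (Uᴴ * U) := by
          rw [hUU, Matrix.mul_one]
      _ = heisenbergHamiltonian n G J * U := by rw [← Matrix.mul_assoc, hH]
  have hinv := Matrix.gibbsState_conj_of_commute hcomm hUU β (siteSpin n x 2 * siteSpin n y 2)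
  have hS : ∀ z : Λ, U * siteSpin n z 2 * Uᴴ = siteSpin n z 0 := by
    intro z
    rw [hU, productOp_conj_siteSpin (fun _ => hV), spinVec_two, hVz]
    rfl
  rw [productOp_conj_mul (fun _ => hV'), ← hU, hS, hS] at hinv
  exact hinv.symm

end Spin

/-! ### The sublattice rotation on the even torus -/

section Rotation

/-- **The sublattice rotation** ([DLS1978] proof of Thm. 6.1; [KLS1988JSP] eqs. (15)–(16)): on
the even torus `(ℤ/2kℤ)^d`, `k ≥ 1`, the rotation by `π` about the `2`-axis on the odd
sublattice is a product unitary `W` with `W (J Σ𝐒_x·𝐒_y) Wᴴ = J·X` and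
`W S¹_x Wᴴ = (-1)^x S¹_x`, `W S²_x Wᴴ = S²_x`, `W S³_x Wᴴ = (-1)^x S³_x`
(`(-1)^x = (-1)^{Σᵢxᵢ}` on canonical representatives, a sublattice sign for even side).
[cite: DLS1978, Thm. 6.1 (proof)] [cite: KLS1988JSP, eqs. (15)–(16)] -/
theorem exists_sublatticeRotation (k : ℕ) [NeZero (2 * k)] (n : ℕ) :
    ∃ W : Op (TorusSite d (2 * k)) (n + 1), W * Wᴴ = 1 ∧ Wᴴ * W = 1 ∧
      (∀ J : ℝ, W * heisenbergTorus d (2 * k) n J * Wᴴ = (J : ℂ) • dlsHamiltonian d (2 * k) n) ∧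
      (∀ x : TorusSite d (2 * k), W * siteSpin n x 0 * Wᴴ =
        ((-1 : ℂ) ^ (∑ i, (x i).val)) • siteSpin n x 0) ∧
      (∀ x : TorusSite d (2 * k), W * siteSpin n x 1 * Wᴴ = siteSpin n x 1) ∧
      (∀ x : TorusSite d (2 * k), W * siteSpin n x 2 * Wᴴ =
        ((-1 : ℂ) ^ (∑ i, (x i).val)) • siteSpin n x 2) := by
  set E := (torusGraph d (2 * k)).edgeFinset with hE
  -- the single-site rotation by `π` about the `2`-axis: `R = V²`
  obtain ⟨V, hV, hV', hVz, hVx, hVy⟩ := exists_unitary_conj_spinZ_eq_spinX n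
  set R := V * V with hR
  have hRR : R * Rᴴ = 1 := by
    rw [hR, conjTranspose_mul, Matrix.mul_assoc, ← Matrix.mul_assoc V Vᴴ, hV, Matrix.one_mul, hV]
  have hRR' : Rᴴ * R = 1 := by
    rw [hR, conjTranspose_mul, Matrix.mul_assoc, ← Matrix.mul_assoc Vᴴ V, hV', Matrix.one_mul, hV']
  have hconj : ∀ M : Matrix (Fin (n + 1)) (Fin (n + 1)) ℂ,
      R * M * Rᴴ = V * (V * M * Vᴴ) * Vᴴ := by
    intro M
    rw [hR, conjTranspose_mul]
    simp only [Matrix.mul_assoc]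
  have hRx : R * spinX n * Rᴴ = -spinX n := by
    rw [hconj, hVx, Matrix.mul_neg, Matrix.neg_mul, hVz]
  have hRy : R * spinY n * Rᴴ = spinY n := by rw [hconj, hVy, hVy]
  have hRz : R * SpinOperators.spinZ n * Rᴴ = -SpinOperators.spinZ n := by
    rw [hconj, hVz, hVx]
  -- the product unitary on the odd sublattice
  set ε : TorusSite d (2 * k) → ZMod 2 := fun x =>
    ∑ j, ZMod.castHom (dvd_mul_right 2 k) (ZMod 2) (x j) with hε
  set u : TorusSite d (2 * k) → Matrix (Fin (n + 1)) (Fin (n + 1)) ℂ :=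
    fun z => if ε z = 0 then 1 else R with hu
  have hua : ∀ z, u z * (u z)ᴴ = 1 := by
    intro z; simp only [hu]; split_ifs
    · rw [conjTranspose_one, Matrix.mul_one]
    · exact hRR
  have hua' : ∀ z, (u z)ᴴ * u z = 1 := by
    intro z; simp only [hu]; split_ifs
    · rw [conjTranspose_one, Matrix.mul_one]
    · exact hRR'
  set sgn : TorusSite d (2 * k) → ℂ := fun z => if ε z = 0 then 1 else -1 with hsgn
  have hux : ∀ z, u z * spinX n * (u z)ᴴ = sgn z • spinX n := by
    intro z; simp only [hu, hsgn]; split_ifs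
    · rw [conjTranspose_one, Matrix.mul_one, Matrix.one_mul, one_smul]
    · rw [hRx, neg_one_smul]
  have huy : ∀ z, u z * spinY n * (u z)ᴴ = spinY n := by
    intro z; simp only [hu]; split_ifs
    · rw [conjTranspose_one, Matrix.mul_one, Matrix.one_mul]
    · exact hRy
  have huz : ∀ z, u z * SpinOperators.spinZ n * (u z)ᴴ = sgn z • SpinOperators.spinZ n := by
    intro z; simp only [hu, hsgn]; split_ifs
    · rw [conjTranspose_one, Matrix.mul_one, Matrix.one_mul, one_smul]
    · rw [hRz, neg_one_smul]
  have hedge : ∀ e ∈ E, ∀ x y, e = s(x, y) → sgn x * sgn y = -1 := by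
    intro e he x y hexy
    subst hexy
    rw [hE, SimpleGraph.mem_edgeFinset, SimpleGraph.mem_edgeSet, torusGraph_adj_iff] at he
    have h01 : ∀ t : ZMod 2, t = 0 ∨ t = 1 := by decide
    have key : ∀ x' : TorusSite d (2 * k), ∀ i, sgn x' * sgn (x' + Pi.single i 1) = -1 := by
      intro x' i
      have hpar : ε (x' + Pi.single i 1) = ε x' + 1 := torusParity_add_single k x' i
      simp only [hsgn, hpar]
      rcases h01 (ε x') with h0 | h1
      · rw [if_pos h0, if_neg (by rw [h0]; decide), one_mul]
      · rw [if_neg (by rw [h1]; decide), if_pos (by rw [h1]; decide), mul_one]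
    obtain ⟨-, ⟨i, rfl⟩ | ⟨i, rfl⟩⟩ := he
    · exact key x i
    · rw [mul_comm]; exact key y i
  set W := productOp u with hW
  have hWx : ∀ x : TorusSite d (2 * k), W * siteSpin n x 0 * Wᴴ = sgn x • siteSpin n x 0 := by
    intro x
    rw [hW, productOp_conj_siteSpin hua, spinVec_zero, hux, onSite_smul']
    rfl
  have hWy : ∀ x : TorusSite d (2 * k), W * siteSpin n x 1 * Wᴴ = siteSpin n x 1 := by
    intro x
    rw [hW, productOp_conj_siteSpin hua, spinVec_one, huy]
    rfl
  have hWz : ∀ x : TorusSite d (2 * k), W * siteSpin n x 2 * Wᴴ = sgn x • siteSpin n x 2 := by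
    intro x
    rw [hW, productOp_conj_siteSpin hua, spinVec_two, huz, onSite_smul']
    rfl
  have hb0 : ∀ x y : TorusSite d (2 * k), sgn x * sgn y = -1 →
      W * spinBond n 0 x y * Wᴴ = -spinBond n 0 x y := by
    intro x y hxy
    rw [hW, productOp_conj_spinBond hua hua', spinVec_zero, hux, hux, onSite_smul', onSite_smul',
      smul_mul_smul_comm, smul_mul_smul_comm, mul_comm (sgn y) (sgn x), hxy, spinBond]
    simp only [neg_smul, one_smul]
    rw [← neg_add, smul_neg]
    rfl
  have hb1 : ∀ x y : TorusSite d (2 * k), W * spinBond n 1 x y * Wᴴ = spinBond n 1 x y := by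
    intro x y
    rw [hW, productOp_conj_spinBond hua hua', spinVec_one, huy, huy, spinBond]
    rfl
  have hb2 : ∀ x y : TorusSite d (2 * k), sgn x * sgn y = -1 →
      W * spinBond n 2 x y * Wᴴ = -spinBond n 2 x y := by
    intro x y hxy
    rw [hW, productOp_conj_spinBond hua hua', spinVec_two, huz, huz, onSite_smul', onSite_smul',
      smul_mul_smul_comm, smul_mul_smul_comm, mul_comm (sgn y) (sgn x), hxy, spinBond]
    simp only [neg_smul, one_smul]
    rw [← neg_add, smul_neg]
    rfl
  -- the staggered sign is the sublattice sign
  have hstag : ∀ x : TorusSite d (2 * k), ((-1 : ℂ) ^ (∑ i, (x i).val)) = sgn x :=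
    fun x => neg_one_pow_sum_val_eq k x
  refine ⟨W, productOp_mul_conjTranspose hua, productOp_conjTranspose_mul hua', fun J => ?_,
    fun x => by rw [hstag, hWx], hWy, fun x => by rw [hstag, hWz]⟩
  -- conjugate the Hamiltonian edge by edge
  rw [heisenbergTorus, heisenbergHamiltonian_eq_bondSum, dlsHamiltonian, ← hE, mul_smul_comm,
    smul_mul_assoc, Finset.mul_sum, Finset.sum_mul]
  congr 1
  refine sum_congr rfl fun e he => ?_
  induction e using Sym2.ind with
  | h x y =>
    have hs := hedge _ he x y rfl
    simp only [Sym2.lift_mk, Matrix.mul_add, Matrix.add_mul, hb0 x y hs, hb1, hb2 x y hs]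
    abel

end Rotation

/-! ### The dictionary between the two Gibbs states -/

section Dictionary

variable (β : ℝ) (k : ℕ) [NeZero (2 * k)] (n : ℕ) (J : ℝ)

/-- `⟨S¹_xS¹_y⟩_{βJ, X} = (-1)^x(-1)^y ⟨S¹_xS¹_y⟩_{β, H}` (`H = Wᴴ(J·X)W`,
`⟨A⟩_{β,H} = ⟨WAWᴴ⟩_{β,J·X} = ⟨WAWᴴ⟩_{βJ,X}`). [cite: DLS1978, Thm. 6.1 (proof: "(b'_p)⁽ⁱ⁾ = b⁽ⁱ⁾_{p'}")] -/
theorem gibbsSpinCorr_dls_zero_eq (x y : TorusSite d (2 * k)) :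
    gibbsSpinCorr (β * J) (dlsHamiltonian d (2 * k) n) 0 x y =
      (-1 : ℝ) ^ (∑ i, (x i).val) * (-1) ^ (∑ i, (y i).val) *
        gibbsSpinCorr β (heisenbergTorus d (2 * k) n J) 0 x y := by
  obtain ⟨W, hW, hW', hH, hWx, -, -⟩ := exists_sublatticeRotation (d := d) k n
  have hHW : heisenbergTorus d (2 * k) n J = Wᴴ * ((J : ℂ) • dlsHamiltonian d (2 * k) n) * W := by
    rw [← hH J]
    simp only [Matrix.mul_assoc]
    rw [hW', Matrix.mul_one, ← Matrix.mul_assoc, hW', Matrix.one_mul]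
  rw [gibbsSpinCorr, gibbsSpinCorr, hHW, Matrix.gibbsState_conjTranspose_mul_mul hW hW',
    show W * (siteSpin n x 0 * siteSpin n y 0) * Wᴴ =
      (W * siteSpin n x 0 * Wᴴ) * (W * siteSpin n y 0 * Wᴴ) by
        simp only [Matrix.mul_assoc]
        rw [← Matrix.mul_assoc Wᴴ W, hW', Matrix.one_mul],
    hWx, hWx, smul_mul_smul_comm, LinearMap.map_smul, smul_eq_mul,
    Matrix.gibbsState_ofReal_smul,
    show ((-1 : ℂ) ^ (∑ i, (x i).val)) * ((-1 : ℂ) ^ (∑ i, (y i).val)) =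
      (((-1 : ℝ) ^ (∑ i, (x i).val) * (-1) ^ (∑ i, (y i).val) : ℝ) : ℂ) by push_cast; ring,
    Complex.re_ofReal_mul]
  have hsq : ((-1 : ℝ) ^ (∑ i, (x i).val) * (-1) ^ (∑ i, (y i).val)) *
      ((-1 : ℝ) ^ (∑ i, (x i).val) * (-1) ^ (∑ i, (y i).val)) = 1 := by
    rw [mul_mul_mul_comm, ← pow_add, ← pow_add, ← two_mul, ← two_mul, pow_mul, pow_mul]
    norm_num
  set s : ℝ := (-1 : ℝ) ^ (∑ i, (x i).val) * (-1) ^ (∑ i, (y i).val)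
  set g : ℝ := (gibbsState (β * J) (dlsHamiltonian d (2 * k) n) (siteSpin n x 0 * siteSpin n y 0)).re
  calc g = (s * s) * g := by rw [hsq, one_mul]
    _ = s * (s * g) := by ring

/-- `⟨S²_xS²_y⟩_{βJ, X} = ⟨S²_xS²_y⟩_{β, H}`. [cite: DLS1978, Thm. 6.1 (proof)] -/
theorem gibbsSpinCorr_dls_one_eq (x y : TorusSite d (2 * k)) :
    gibbsSpinCorr (β * J) (dlsHamiltonian d (2 * k) n) 1 x y =
      gibbsSpinCorr β (heisenbergTorus d (2 * k) n J) 1 x y := by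
  obtain ⟨W, hW, hW', hH, -, hWy, -⟩ := exists_sublatticeRotation (d := d) k n
  have hHW : heisenbergTorus d (2 * k) n J = Wᴴ * ((J : ℂ) • dlsHamiltonian d (2 * k) n) * W := by
    rw [← hH J]
    simp only [Matrix.mul_assoc]
    rw [hW', Matrix.mul_one, ← Matrix.mul_assoc, hW', Matrix.one_mul]
  rw [gibbsSpinCorr, gibbsSpinCorr, hHW, Matrix.gibbsState_conjTranspose_mul_mul hW hW',
    show W * (siteSpin n x 1 * siteSpin n y 1) * Wᴴ =
      (W * siteSpin n x 1 * Wᴴ) * (W * siteSpin n y 1 * Wᴴ) by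
        simp only [Matrix.mul_assoc]
        rw [← Matrix.mul_assoc Wᴴ W, hW', Matrix.one_mul],
    hWy, hWy, Matrix.gibbsState_ofReal_smul]

/-- `⟨S³_xS³_y⟩_{βJ, X} = (-1)^x(-1)^y ⟨S³_xS³_y⟩_{β, H}`. [cite: DLS1978, Thm. 6.1 (proof)] -/
theorem gibbsSpinCorr_dls_two_eq (x y : TorusSite d (2 * k)) :
    gibbsSpinCorr (β * J) (dlsHamiltonian d (2 * k) n) 2 x y =
      (-1 : ℝ) ^ (∑ i, (x i).val) * (-1) ^ (∑ i, (y i).val) *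
        gibbsSpinCorr β (heisenbergTorus d (2 * k) n J) 2 x y := by
  obtain ⟨W, hW, hW', hH, -, -, hWz⟩ := exists_sublatticeRotation (d := d) k n
  have hHW : heisenbergTorus d (2 * k) n J = Wᴴ * ((J : ℂ) • dlsHamiltonian d (2 * k) n) * W := by
    rw [← hH J]
    simp only [Matrix.mul_assoc]
    rw [hW', Matrix.mul_one, ← Matrix.mul_assoc, hW', Matrix.one_mul]
  rw [gibbsSpinCorr, gibbsSpinCorr, hHW, Matrix.gibbsState_conjTranspose_mul_mul hW hW',
    show W * (siteSpin n x 2 * siteSpin n y 2) * Wᴴ =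
      (W * siteSpin n x 2 * Wᴴ) * (W * siteSpin n y 2 * Wᴴ) by
        simp only [Matrix.mul_assoc]
        rw [← Matrix.mul_assoc Wᴴ W, hW', Matrix.one_mul],
    hWz, hWz, smul_mul_smul_comm, LinearMap.map_smul, smul_eq_mul,
    Matrix.gibbsState_ofReal_smul,
    show ((-1 : ℂ) ^ (∑ i, (x i).val)) * ((-1 : ℂ) ^ (∑ i, (y i).val)) =
      (((-1 : ℝ) ^ (∑ i, (x i).val) * (-1) ^ (∑ i, (y i).val) : ℝ) : ℂ) by push_cast; ring,
    Complex.re_ofReal_mul]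
  have hsq : ((-1 : ℝ) ^ (∑ i, (x i).val) * (-1) ^ (∑ i, (y i).val)) *
      ((-1 : ℝ) ^ (∑ i, (x i).val) * (-1) ^ (∑ i, (y i).val)) = 1 := by
    rw [mul_mul_mul_comm, ← pow_add, ← pow_add, ← two_mul, ← two_mul, pow_mul, pow_mul]
    norm_num
  set s : ℝ := (-1 : ℝ) ^ (∑ i, (x i).val) * (-1) ^ (∑ i, (y i).val)
  set g : ℝ := (gibbsState (β * J) (dlsHamiltonian d (2 * k) n) (siteSpin n x 2 * siteSpin n y 2)).re
  calc g = (s * s) * g := by rw [hsq, one_mul]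
    _ = s * (s * g) := by ring

/-- **All three correlations of the antiferromagnet coincide** (`SU(2)` symmetry):
`G²_H = G¹_H` on the torus. [cite: DLS1978, §6 ("By symmetry")] -/
theorem gibbsSpinCorr_heisenberg_one (L : ℕ) [NeZero L] (x y : TorusSite d L) :
    gibbsSpinCorr β (heisenbergTorus d L n J) 1 x y = gibbsSpinCorr β (heisenbergTorus d L n J) 0 x y := by
  rw [gibbsSpinCorr, gibbsSpinCorr, heisenbergTorus, gibbsState_heisenberg_spinOne_mul]

/-- `G³_H = G¹_H` on the torus. [cite: DLS1978, §6 ("By symmetry")] -/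
theorem gibbsSpinCorr_heisenberg_two (L : ℕ) [NeZero L] (x y : TorusSite d L) :
    gibbsSpinCorr β (heisenbergTorus d L n J) 2 x y = gibbsSpinCorr β (heisenbergTorus d L n J) 0 x y := by
  rw [gibbsSpinCorr, gibbsSpinCorr, heisenbergTorus, gibbsState_heisenberg_spinTwo_mul]

/-- Neighbouring sites of the even torus carry opposite staggered signs:
`(-1)^x (-1)^{x+eᵢ} = -1`. [cite: DLS1978, §6] -/
theorem stagger_mul_stagger_add_single (x : TorusSite d (2 * k)) (i : Fin d) :
    (-1 : ℝ) ^ (∑ j, (x j).val) *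
      (-1) ^ (∑ j, ((x + Pi.single i 1 : TorusSite d (2 * k)) j).val) = -1 := by
  have hx := neg_one_pow_sum_val_eq (d := d) k x
  have hy := neg_one_pow_sum_val_eq (d := d) k (x + Pi.single i 1)
  have hpar := torusParity_add_single k x i
  have h01 : ∀ t : ZMod 2, t = 0 ∨ t = 1 := by decide
  have hC : ((-1 : ℂ) ^ (∑ j, (x j).val)) *
      ((-1 : ℂ) ^ (∑ j, ((x + Pi.single i 1 : TorusSite d (2 * k)) j).val)) = -1 := by
    rw [hx, hy, hpar]
    rcases h01 (∑ j, ZMod.castHom (dvd_mul_right 2 k) (ZMod 2) (x j)) with h0 | h1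
    · rw [if_pos h0, if_neg (by rw [h0]; decide), one_mul]
    · rw [if_neg (by rw [h1]; decide), if_pos (by rw [h1]; decide), mul_one]
  exact_mod_cast hC

/-- **The bond correlations of `X` in terms of the antiferromagnet**: with
`ε = -e¹_H` (minus the bond average of `⟨S¹_xS¹_{x+eᵢ}⟩_{β,H}`), `e⁰_X = ε`, `e¹_X = -ε`,
`e²_X = ε` at inverse temperature `βJ`. [cite: DLS1978, Thm. 6.1 (proof), §6] -/
theorem gibbsBondCorr_dls_eq :
    gibbsBondCorr (β * J) (dlsHamiltonian d (2 * k) n) 0 =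
        -gibbsBondCorr β (heisenbergTorus d (2 * k) n J) 0 ∧
      gibbsBondCorr (β * J) (dlsHamiltonian d (2 * k) n) 1 =
        gibbsBondCorr β (heisenbergTorus d (2 * k) n J) 0 ∧
      gibbsBondCorr (β * J) (dlsHamiltonian d (2 * k) n) 2 =
        -gibbsBondCorr β (heisenbergTorus d (2 * k) n J) 0 := by
  refine ⟨?_, ?_, ?_⟩
  · rw [gibbsBondCorr, gibbsBondCorr, ← neg_div, ← sum_neg_distrib]
    congr 1
    refine sum_congr rfl fun x _ => ?_
    rw [← sum_neg_distrib]
    refine sum_congr rfl fun i _ => ?_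
    rw [gibbsSpinCorr_dls_zero_eq, stagger_mul_stagger_add_single, neg_one_mul]
  · rw [gibbsBondCorr, gibbsBondCorr]
    congr 1
    refine sum_congr rfl fun x _ => sum_congr rfl fun i _ => ?_
    rw [gibbsSpinCorr_dls_one_eq, gibbsSpinCorr_heisenberg_one]
  · rw [gibbsBondCorr, gibbsBondCorr, ← neg_div, ← sum_neg_distrib]
    congr 1
    refine sum_congr rfl fun x _ => ?_
    rw [← sum_neg_distrib]
    refine sum_congr rfl fun i _ => ?_
    rw [gibbsSpinCorr_dls_two_eq, stagger_mul_stagger_add_single, neg_one_mul,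
      gibbsSpinCorr_heisenberg_two]

/-- **The Néel order parameter in the rotated frame**: on the even torus of side `2k`,
`Σ_{x,y} (-1)^x(-1)^y ⟨𝐒_x·𝐒_y⟩_{β,H} = 3 Σ_{x,y} ⟨S¹_xS¹_y⟩_{βJ,X}` (the staggered
magnetisation of the antiferromagnet is the plain magnetisation of `X`, [DLS1978] §6, and the
three components contribute equally). [cite: DLS1978, §6, Thm. 6.1 (proof)] -/
theorem staggeredSum_spinSpinCorrTorus_eq :
    ∑ x : TorusSite d (2 * k), ∑ y : TorusSite d (2 * k),
        (-1 : ℝ) ^ (∑ i, (x i).val) * (-1) ^ (∑ i, (y i).val) *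
          spinSpinCorrTorus β (2 * k) n J x y =
      3 * ∑ x : TorusSite d (2 * k), ∑ y : TorusSite d (2 * k),
        gibbsSpinCorr (β * J) (dlsHamiltonian d (2 * k) n) 0 x y := by
  rw [mul_sum]
  refine sum_congr rfl fun x _ => ?_
  rw [mul_sum]
  refine sum_congr rfl fun y _ => ?_
  have h3 : spinSpinCorrTorus β (2 * k) n J x y =
      3 * gibbsSpinCorr β (heisenbergTorus d (2 * k) n J) 0 x y := by
    rw [spinSpinCorrTorus_of_neZero, Complex.re_sum, Fin.sum_univ_three]
    simp only [thermalCorr]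
    have h1 := gibbsSpinCorr_heisenberg_one β n J (2 * k) x y
    have h2 := gibbsSpinCorr_heisenberg_two β n J (2 * k) x y
    simp only [gibbsSpinCorr] at h1 h2 ⊢
    rw [h1, h2]
    ring
  rw [h3, gibbsSpinCorr_dls_zero_eq]
  ring

end Dictionary

/-! ### The energy bound for `X` -/

section Energy

variable (L : ℕ) [NeZero L] (n : ℕ)

/-- The diagonal element of a rotated bond at the all-up configuration `|0…0⟩` (`x ≠ y`):
`⟨0|(-b⁰ + b¹ - b²)(x,y)|0⟩ = -S²` (`⟨0|Sˣ|0⟩ = ⟨0|Sʸ|0⟩ = 0`, `⟨0|Sᶻ|0⟩ = S = n/2`): the Néel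
energy of the bond `𝐒_x·𝐒_y` before the rotation. [cite: KLS1988JSP, after eq. (4) (Néel trial state)] -/
theorem dlsBond_apply_zero {Λ : Type*} [Fintype Λ] [DecidableEq Λ] {x y : Λ} (hxy : x ≠ y) :
    (-spinBond n 0 x y + spinBond n 1 x y - spinBond n 2 x y : Op Λ (n + 1))
        (fun _ => 0) (fun _ => 0) = -(((n : ℂ) / 2) ^ 2) := by
  rw [Matrix.sub_apply, Matrix.add_apply, Matrix.neg_apply, spinBond_apply_self hxy,
    spinBond_apply_self hxy, spinBond_apply_self hxy, spinVec_zero, spinVec_one, spinVec_two,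
    spinX_apply_self, spinY_apply_zero_zero, spinZ_apply_zero_zero]
  ring

/-- **The Néel energy**: `⟨0…0| X |0…0⟩ = -S²|E|`. [cite: KLS1988JSP, after eq. (4)] -/
theorem dlsHamiltonian_apply_zero :
    dlsHamiltonian d L n (fun _ => 0) (fun _ => 0) =
      -(((n : ℂ) / 2) ^ 2 * ((torusGraph d L).edgeFinset.card : ℂ)) := by
  rw [dlsHamiltonian, Matrix.sum_apply]
  calc ∑ e ∈ (torusGraph d L).edgeFinset,
        Sym2.lift ⟨fun x y => -spinBond n 0 x y + spinBond n 1 x y - spinBond n 2 x y,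
          dlsBond_symm n⟩ e (fun _ => 0) (fun _ => 0)
      = ∑ _e ∈ (torusGraph d L).edgeFinset, (-(((n : ℂ) / 2) ^ 2)) := by
        refine sum_congr rfl fun e he => ?_
        revert he
        refine Sym2.ind (fun x y => ?_) e
        intro he
        rw [Sym2.lift_mk]
        exact dlsBond_apply_zero n (ne_of_mk_mem_edgeFinset he)
    _ = -(((n : ℂ) / 2) ^ 2 * ((torusGraph d L).edgeFinset.card : ℂ)) := by
        rw [sum_const, nsmul_eq_mul]
        ring

/-- **The thermal energy of `X`, edge by edge**: `Re⟨X⟩_β = Σ_E (-G⁰ + G¹ - G²)`.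
[cite: DLS1978, §6] -/
theorem re_gibbsState_dlsHamiltonian (β : ℝ) :
    (gibbsState β (dlsHamiltonian d L n) (dlsHamiltonian d L n)).re =
      ∑ e ∈ (torusGraph d L).edgeFinset, Sym2.lift
        ⟨fun x y => -gibbsSpinCorr β (dlsHamiltonian d L n) 0 x y +
          gibbsSpinCorr β (dlsHamiltonian d L n) 1 x y - gibbsSpinCorr β (dlsHamiltonian d L n) 2 x y,
          fun x y => by
            simp only [gibbsSpinCorr_symm β (dlsHamiltonian_isHermitian d L n) _ x y]⟩ e := by
  conv_lhs => rw [show gibbsState β (dlsHamiltonian d L n) (dlsHamiltonian d L n) =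
    gibbsState β (dlsHamiltonian d L n) (∑ e ∈ (torusGraph d L).edgeFinset,
      Sym2.lift ⟨fun x y => -spinBond n 0 x y + spinBond n 1 x y - spinBond n 2 x y,
        dlsBond_symm n⟩ e) from rfl]
  rw [map_sum, Complex.re_sum]
  refine sum_congr rfl fun e _ => ?_
  induction e using Sym2.ind with
  | h x y =>
    rw [Sym2.lift_mk, Sym2.lift_mk, map_sub, map_add, map_neg, Complex.sub_re, Complex.add_re,
      Complex.neg_re, re_gibbsState_spinBond' β (dlsHamiltonian_isHermitian d L n),
      re_gibbsState_spinBond' β (dlsHamiltonian_isHermitian d L n),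
      re_gibbsState_spinBond' β (dlsHamiltonian_isHermitian d L n)]

/-- `log dim = |Λ| log(n+1)` for spins `n/2` on the torus. [folklore] -/
theorem log_card_tensorIndex' :
    Real.log (Fintype.card (TensorIndex (TorusSite d L) (n + 1))) =
      (Fintype.card (TorusSite d L) : ℝ) * Real.log (n + 1) := by
  rw [show Fintype.card (TensorIndex (TorusSite d L) (n + 1)) = (n + 1) ^ Fintype.card (TorusSite d L)
    by rw [Fintype.card_fun, Fintype.card_fin], Nat.cast_pow, Real.log_pow]
  push_cast
  ring

/-- **The energy bound for the bond correlations of `X`** ([DLS1978] §6 with the Néel trial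
state of [KLS1988JSP] after eq. (4), at positive temperature through the energy–entropy bound):
for `d ≥ 1`, `L ≥ 3`, `β > 0`,
`e⁰ - e¹ + e² ≥ S² - log(n+1)/(dβ)` (`S = n/2`): indeed
`-|E|(e⁰ - e¹ + e²) = Re⟨X⟩_β ≤ ⟨0|X|0⟩ + log(dim)/β = -S²|E| + |Λ|log(n+1)/β` and `|E| = d|Λ|`.
[cite: DLS1978, §6 (the constant `D`)] [cite: KLS1988JSP, after eq. (4)] -/
theorem dls_bondCorr_energy_bound (hd : 1 ≤ d) (hL : 3 ≤ L) {β : ℝ} (hβ : 0 < β) :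
    ((n : ℝ) / 2) ^ 2 - Real.log (n + 1) / (d * β) ≤
      gibbsBondCorr β (dlsHamiltonian d L n) 0 - gibbsBondCorr β (dlsHamiltonian d L n) 1 +
        gibbsBondCorr β (dlsHamiltonian d L n) 2 := by
  set E := (torusGraph d L).edgeFinset with hE
  set X := dlsHamiltonian d L n with hX
  have hHerm : X.IsHermitian := dlsHamiltonian_isHermitian d L n
  set g : Sym2 (TorusSite d L) → ℝ := Sym2.lift
    ⟨fun x y => -gibbsSpinCorr β X 0 x y + gibbsSpinCorr β X 1 x y - gibbsSpinCorr β X 2 x y,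
      fun x y => by simp only [gibbsSpinCorr_symm β hHerm _ x y]⟩ with hg
  -- (1) `Re⟨X⟩ = Σ_E g`
  have h1 : (gibbsState β X X).re = ∑ e ∈ E, g e := re_gibbsState_dlsHamiltonian L n β
  -- (2) the energy–entropy bound against `|0…0⟩`
  set v : TensorIndex (TorusSite d L) (n + 1) → ℂ := Pi.single (fun _ => 0) 1 with hv
  have hstar : star v = v := by rw [hv, ← Pi.single_star, star_one]
  have hψ : star v ⬝ᵥ v = 1 := by
    rw [hstar, hv, single_dotProduct, Pi.single_eq_same, one_mul]
  have h2 := Matrix.re_gibbsState_hamiltonian_le_rayleigh hHerm hβ v hψ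
  rw [hstar, hv, single_dotProduct, one_mul, mulVec_single_one, Matrix.col_apply, hX,
    dlsHamiltonian_apply_zero, log_card_tensorIndex',
    show -(((n : ℂ) / 2) ^ 2 * (E.card : ℂ)) = ((-(((n : ℝ) / 2) ^ 2 * (E.card : ℝ)) : ℝ) : ℂ) by
      push_cast; ring, Complex.ofReal_re, ← hX] at h2
  -- (3) cardinalities
  have hcard : (Fintype.card (TorusSite d L) : ℝ) = (L : ℝ) ^ d := by
    rw [Fintype.card_pi, prod_const, ZMod.card, card_univ, Fintype.card_fin]
    push_cast
    ring
  have hL2 : 2 ≤ L := by omega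
  have hL3 : L ≠ 2 := by omega
  have h4 := sum_pairs_eq_sum_edgeFinset L hL2 g
  have h5 := sum_pairs_eq_sum_edgeFinset (d := d) L hL2 (fun _ => (1 : ℝ))
  simp only [sum_const, card_univ, nsmul_eq_mul, mul_one, Fintype.card_fin, if_neg hL3,
    one_mul] at h5 h4
  rw [hcard] at h5 h2
  have hLpos : (0 : ℝ) < (L : ℝ) ^ d := by
    have : (0 : ℝ) < L := by exact_mod_cast (show 0 < L by omega)
    positivity
  have hd0 : (0 : ℝ) < d := by exact_mod_cast (show 0 < d by omega)
  have hpos : (0 : ℝ) < (d : ℝ) * (L : ℝ) ^ d := by positivity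
  have hEcard : (E.card : ℝ) = (d : ℝ) * (L : ℝ) ^ d := by rw [← h5]; ring
  rw [hEcard] at h2
  -- the bond averages through `g`
  have hsum : gibbsBondCorr β X 0 - gibbsBondCorr β X 1 + gibbsBondCorr β X 2 =
      -(∑ e ∈ E, g e) / ((d : ℝ) * (L : ℝ) ^ d) := by
    rw [gibbsBondCorr, gibbsBondCorr, gibbsBondCorr, ← sub_div, ← add_div, ← h4, ← sum_sub_distrib,
      ← sum_add_distrib, ← sum_neg_distrib]
    congr 1
    refine sum_congr rfl fun x _ => ?_
    rw [← sum_sub_distrib, ← sum_add_distrib, ← sum_neg_distrib]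
    refine sum_congr rfl fun i _ => ?_
    simp only [hg, Sym2.lift_mk]
    ring
  rw [hsum, le_div_iff₀ hpos]
  have key : ∑ e ∈ E, g e ≤
      -(((n : ℝ) / 2) ^ 2 * ((d : ℝ) * (L : ℝ) ^ d)) + (L : ℝ) ^ d * Real.log (n + 1) / β :=
    h1.symm.le.trans h2
  have hdiv : (((n : ℝ) / 2) ^ 2 - Real.log (n + 1) / (d * β)) * ((d : ℝ) * (L : ℝ) ^ d) =
      ((n : ℝ) / 2) ^ 2 * ((d : ℝ) * (L : ℝ) ^ d) - (L : ℝ) ^ d * Real.log (n + 1) / β := by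
    field_simp
  rw [hdiv]
  linarith

end Energy

end Literature.MathematicalPhysics.QuantumLattice

namespace Literature.MathematicalPhysics.QuantumLattice

variable {d : ℕ}

/-! ### A priori bounds -/

section Apriori

variable (β : ℝ) {L : ℕ} [NeZero L] {n : ℕ} {H : Op (TorusSite d L) (n + 1)}

/-- **A priori bound** `|G^α(x,y)| ≤ S²` for the thermal two-point function of a Hermitian
Hamiltonian (`S²·1 ∓ S^α_xS^α_y ≥ 0`, positivity and normalisation of the Gibbs state). [folklore] -/
theorem abs_gibbsSpinCorr_le (hH : H.IsHermitian) (α : Fin 3) (x y : TorusSite d L) :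
    |gibbsSpinCorr β H α x y| ≤ ((n : ℝ) / 2) ^ 2 := by
  rw [gibbsSpinCorr]
  have hone : gibbsState β H 1 = 1 := gibbsState_one β H (partitionFn_pos β hH).ne'
  have hup := gibbsState_nonneg_of_posSemidef β hH (posSemidef_sq_smul_one_sub_siteSpin_mul' n x y α)
  rw [map_sub, LinearMap.map_smul, hone, smul_eq_mul, mul_one] at hup
  obtain ⟨hup_re, -⟩ := Complex.nonneg_iff.mp hup
  rw [Complex.sub_re, re_half_sq] at hup_re
  have hlo := gibbsState_nonneg_of_posSemidef β hH (posSemidef_sq_smul_one_add_siteSpin_mul' n x y α)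
  rw [map_add, LinearMap.map_smul, hone, smul_eq_mul, mul_one] at hlo
  obtain ⟨hlo_re, -⟩ := Complex.nonneg_iff.mp hlo
  rw [Complex.add_re, re_half_sq] at hlo_re
  rw [abs_le]
  constructor <;> linarith

/-- `|Λ|⁻¹ ĝ^α_0 = |Λ|⁻²Σ_{x,y}G^α(x,y) ≤ S²`. [folklore] -/
theorem gibbsStructureFactor_zero_div_le (hH : H.IsHermitian) (α : Fin 3) :
    gibbsStructureFactor β H α (0 : TorusSite d L) / (L : ℝ) ^ d ≤ ((n : ℝ) / 2) ^ 2 := by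
  have hL : (0 : ℝ) < (L : ℝ) ^ d := by
    have : (0 : ℝ) < L := by exact_mod_cast Nat.pos_of_ne_zero (NeZero.ne L)
    positivity
  rw [gibbsStructureFactor_zero_momentum, div_div, div_le_iff₀ (by positivity)]
  calc ∑ x : TorusSite d L, ∑ y : TorusSite d L, gibbsSpinCorr β H α x y
      ≤ ∑ _x : TorusSite d L, ∑ _y : TorusSite d L, ((n : ℝ) / 2) ^ 2 :=
        sum_le_sum fun x _ => sum_le_sum fun y _ => (le_abs_self _).trans (abs_gibbsSpinCorr_le β hH α x y)
    _ = ((n : ℝ) / 2) ^ 2 * ((L : ℝ) ^ d * (L : ℝ) ^ d) := by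
        rw [sum_const, sum_const, card_univ, nsmul_eq_mul, nsmul_eq_mul, Fintype.card_pi, prod_const,
          ZMod.card, card_univ, Fintype.card_fin, Nat.cast_pow]
        ring

end Apriori

/-! ### The Kennedy–Lieb–Shastry inequality at positive temperature, rotated frame -/

section KLS

/-- The pointwise step (IR) ⇒ integrand of [KLS1988JSP] (4) plus the thermal term: if
`0 ≤ g ≤ b₀ + ½[t(d + C)/E]^{1/2}`, `t ≥ 0`, `E, d > 0`, `b₀ ≥ 0`, then
`g (C/d) ≤ {C/d}₊ b₀ + ½ √t [((d + C)/E)^{1/2} {C/d}₊]`. [cite: KLS1988JSP, eq. (4)] -/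
theorem dls_pointwise {g E C dd t b₀ : ℝ} (hg : 0 ≤ g) (hdd : 0 < dd) (hb₀ : 0 ≤ b₀)
    (ht : 0 ≤ t) (hA : g ≤ b₀ + 1 / 2 * Real.sqrt (t * (dd + C) / E)) :
    g * (C / dd) ≤ max (C / dd) 0 * b₀ +
      1 / 2 * Real.sqrt t * (Real.sqrt ((dd + C) / E) * max (C / dd) 0) := by
  rcases le_or_gt C 0 with hC | hC
  · calc g * (C / dd) ≤ 0 :=
          mul_nonpos_of_nonneg_of_nonpos hg (div_nonpos_of_nonpos_of_nonneg hC hdd.le)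
      _ ≤ _ := by positivity
  · have hCd : 0 ≤ C / dd := by positivity
    rw [max_eq_left hCd]
    have hsq : Real.sqrt (t * (dd + C) / E) = Real.sqrt t * Real.sqrt ((dd + C) / E) := by
      rw [mul_div_assoc, Real.sqrt_mul ht]
    calc g * (C / dd) ≤ (b₀ + 1 / 2 * Real.sqrt (t * (dd + C) / E)) * (C / dd) :=
          mul_le_mul_of_nonneg_right hA hCd
      _ = _ := by rw [hsq]; ring

variable (n : ℕ)

/-- **[KLS1988JSP] eq. (4) at positive temperature, in the rotated frame.** On the even torus of
side `L = 2k ≥ 4`, `d ≥ 1`, for `β > 0`: if `t = e₃ - e₂ ≥ 0` then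
`e₁ ≤ |Λ|⁻¹ĝ₀ + ½ √t R_L + T_L/(2β)` (sum rule split at `q = 0`, (IR) on `{Σcos qᵢ > 0}`,
`R_L` the punctured Riemann sum of the KLS integrand, `T_L = |Λ|⁻¹Σ_{q≠0}E_q⁻¹`).
[cite: KLS1988JSP, eqs. (3)–(4)] [cite: DLS1978, Thm. 5.1] -/
theorem dls_ineq (hd : 1 ≤ d) {k : ℕ} [NeZero (2 * k)] (hk : 2 ≤ k) {β : ℝ} (hβ : 0 < β)
    (ht : 0 ≤ gibbsBondCorr β (dlsHamiltonian d (2 * k) n) 2 -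
      gibbsBondCorr β (dlsHamiltonian d (2 * k) n) 1) :
    gibbsBondCorr β (dlsHamiltonian d (2 * k) n) 0 ≤
      gibbsStructureFactor β (dlsHamiltonian d (2 * k) n) 0 (0 : TorusSite d (2 * k)) /
          ((2 * k : ℕ) : ℝ) ^ d +
        1 / 2 * Real.sqrt (gibbsBondCorr β (dlsHamiltonian d (2 * k) n) 2 -
            gibbsBondCorr β (dlsHamiltonian d (2 * k) n) 1) * klsRiemannSum d (2 * k) +
        1 / (2 * β) * torusGreen (0 : TorusSite d (2 * k)) := by
  have hd0 : (0 : ℝ) < d := by exact_mod_cast (show 0 < d by omega)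
  have hL : (0 : ℝ) < ((2 * k : ℕ) : ℝ) ^ d := by positivity
  set X := dlsHamiltonian d (2 * k) n with hX
  set t := gibbsBondCorr β X 2 - gibbsBondCorr β X 1 with ht_def
  have hsum : ∑ q : TorusSite d (2 * k), gibbsStructureFactor β X 0 q *
      (torusCosSum (2 * k) q / d) ≤
      gibbsStructureFactor β X 0 (0 : TorusSite d (2 * k)) +
        (1 / 2 * Real.sqrt t *
          ∑ q ∈ (univ : Finset (TorusSite d (2 * k))).erase 0,
            klsIntegrand d (latticeMomentum (2 * k) q) +
        1 / (2 * β) * ∑ q ∈ (univ : Finset (TorusSite d (2 * k))).erase 0,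
            1 / dispersion (latticeMomentum (2 * k) q)) := by
    rw [← add_sum_erase _ _ (mem_univ (0 : TorusSite d (2 * k))), torusCosSum_zero,
      div_self hd0.ne', mul_one, mul_sum, mul_sum, ← sum_add_distrib]
    refine add_le_add le_rfl (sum_le_sum fun q hq => ?_)
    have hq0 : q ≠ 0 := (mem_erase.1 hq).1
    have hE := dispersion_latticeMomentum_pos (d := d) hq0
    obtain ⟨hg, hAq⟩ := dls_infraredBound n k hk (by omega) hβ q hq0
    rw [← hX] at hg
    rw [← hX, ← ht_def] at hAq
    have hb₀ : 0 ≤ 1 / (2 * β * dispersion (latticeMomentum (2 * k) q)) := by positivity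
    have hpt := dls_pointwise hg hd0 hb₀ ht hAq
    rw [klsIntegrand_latticeMomentum]
    have hmax : max (torusCosSum (2 * k) q / d) 0 ≤ 1 :=
      max_le ((div_le_one hd0).2 (torusCosSum_le _ _)) zero_le_one
    have hterm : max (torusCosSum (2 * k) q / d) 0 *
        (1 / (2 * β * dispersion (latticeMomentum (2 * k) q))) ≤
        1 / (2 * β) * (1 / dispersion (latticeMomentum (2 * k) q)) := by
      calc max (torusCosSum (2 * k) q / d) 0 *
            (1 / (2 * β * dispersion (latticeMomentum (2 * k) q)))
          ≤ 1 * (1 / (2 * β * dispersion (latticeMomentum (2 * k) q))) :=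
            mul_le_mul_of_nonneg_right hmax hb₀
        _ = 1 / (2 * β) * (1 / dispersion (latticeMomentum (2 * k) q)) := by
            rw [one_mul, one_div_mul_one_div]
    linarith
  have hC := gibbsStructureFactor_sumRule β (dlsHamiltonian_isHermitian d (2 * k) n) hd 0
  rw [← hX] at hC
  rw [klsRiemannSum_of_neZero, torusGreen_zero_eq]
  calc gibbsBondCorr β X 0 = (∑ q : TorusSite d (2 * k), gibbsStructureFactor β X 0 q *
          (torusCosSum (2 * k) q / d)) / ((2 * k : ℕ) : ℝ) ^ d := hC.symm
    _ ≤ (gibbsStructureFactor β X 0 (0 : TorusSite d (2 * k)) +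
        (1 / 2 * Real.sqrt t *
          ∑ q ∈ (univ : Finset (TorusSite d (2 * k))).erase 0,
            klsIntegrand d (latticeMomentum (2 * k) q) +
        1 / (2 * β) * ∑ q ∈ (univ : Finset (TorusSite d (2 * k))).erase 0,
            1 / dispersion (latticeMomentum (2 * k) q))) / ((2 * k : ℕ) : ℝ) ^ d :=
        div_le_div_of_nonneg_right hsum hL.le
    _ = _ := by rw [add_div, add_div, mul_div_assoc, mul_div_assoc, add_assoc]

end KLS

/-! ### The Néel order parameter on the even torus -/

section OrderParameter

/-- The volume-by-volume identity behind `HasStaggeredEvenTorusLRO` (any side `L ≠ 0`): the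
staggered double sum of the pull-back over the fundamental domain, normalised by its squared
cardinality, is the staggered double sum over the torus with signs on canonical representatives,
normalised by `L^{2d}`. [cite: DLS1978, §1 eq. (4)] -/
theorem staggeredSum_torusPullback_of_neZero (G : (L : ℕ) → TorusSite d L → TorusSite d L → ℝ)
    (L : ℕ) [NeZero L] :
    (∑ x ∈ halfOpenBox d L, ∑ y ∈ halfOpenBox d L,
        latticeStagger x * latticeStagger y * torusPullback G L x y) /
      ((halfOpenBox d L).card : ℝ) ^ 2 =
    (∑ x : TorusSite d L, ∑ y : TorusSite d L,
        (-1 : ℝ) ^ (∑ i, (x i).val) * (-1) ^ (∑ i, (y i).val) * G L x y) / (L : ℝ) ^ (2 * d) := by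
  have hnum : (∑ x ∈ halfOpenBox d L, ∑ y ∈ halfOpenBox d L,
        latticeStagger x * latticeStagger y * torusPullback G L x y) =
      ∑ x : TorusSite d L, ∑ y : TorusSite d L,
        (-1 : ℝ) ^ (∑ i, (x i).val) * (-1) ^ (∑ i, (y i).val) * G L x y := by
    calc (∑ x ∈ halfOpenBox d L, ∑ y ∈ halfOpenBox d L,
          latticeStagger x * latticeStagger y * torusPullback G L x y)
        = ∑ x ∈ halfOpenBox d L, ∑ y ∈ halfOpenBox d L,
            (-1 : ℝ) ^ (∑ i, (Torus.proj L x i).val) * (-1) ^ (∑ i, (Torus.proj L y i).val) *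
              G L (Torus.proj L x) (Torus.proj L y) := by
          refine Finset.sum_congr rfl fun x hx => Finset.sum_congr rfl fun y hy => ?_
          rw [latticeStagger_eq_of_mem_halfOpenBox hx, latticeStagger_eq_of_mem_halfOpenBox hy,
            torusPullback_apply]
      _ = _ := sum_sq_halfOpenBox_comp_torusProj (fun s t : TorusSite d L =>
            (-1 : ℝ) ^ (∑ i, (s i).val) * (-1) ^ (∑ i, (t i).val) * G L s t)
  rw [hnum, card_halfOpenBox_sq_real]

variable (β : ℝ) (n : ℕ) (J : ℝ)

/-- **The Néel order parameter is `3|Λ|⁻¹ĝ₀` of the rotated frame**: on the even torus of side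
`2k`, `|Λ|⁻²Σ_{x,y}(-1)^{x+y}⟨𝐒_x·𝐒_y⟩_{β,H} = 3 |Λ|⁻¹ ĝ¹₀(βJ; X)`.
[cite: DLS1978, §6, Thm. 6.1 (proof)] -/
theorem dls_orderParameter_eq (k : ℕ) [NeZero (2 * k)] :
    (∑ x : TorusSite d (2 * k), ∑ y : TorusSite d (2 * k),
        (-1 : ℝ) ^ (∑ i, (x i).val) * (-1) ^ (∑ i, (y i).val) *
          spinSpinCorrTorus β (2 * k) n J x y) / (((2 * k : ℕ) : ℝ)) ^ (2 * d) =
      3 * (gibbsStructureFactor (β * J) (dlsHamiltonian d (2 * k) n) 0 (0 : TorusSite d (2 * k)) /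
        ((2 * k : ℕ) : ℝ) ^ d) := by
  rw [staggeredSum_spinSpinCorrTorus_eq, gibbsStructureFactor_zero_momentum, div_div, ← pow_add,
    show d + d = 2 * d by ring, mul_div_assoc]

/-- Boundedness of the Néel order parameter: `≤ 3S²`. [folklore] -/
theorem dls_orderParameter_le (hd : 1 ≤ d) (k : ℕ) :
    (∑ x ∈ halfOpenBox d (2 * k), ∑ y ∈ halfOpenBox d (2 * k),
        latticeStagger x * latticeStagger y *
          torusPullback (fun L x y => spinSpinCorrTorus (d := d) β L n J x y) (2 * k) x y) /
      ((halfOpenBox d (2 * k)).card : ℝ) ^ 2 ≤ 3 * ((n : ℝ) / 2) ^ 2 := by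
  rcases Nat.eq_zero_or_pos k with rfl | hk
  · have hc : (halfOpenBox d (2 * 0)).card = 0 := by
      rw [card_halfOpenBox, Nat.mul_zero, zero_pow (by omega)]
    rw [Finset.card_eq_zero.1 hc, sum_empty, zero_div]
    positivity
  · haveI : NeZero (2 * k) := ⟨by omega⟩
    rw [staggeredSum_torusPullback_of_neZero, dls_orderParameter_eq]
    exact mul_le_mul_of_nonneg_left
      (gibbsStructureFactor_zero_div_le (β * J) (dlsHamiltonian_isHermitian d (2 * k) n) 0) (by norm_num)

end OrderParameter

/-! ### The theorem -/

section Main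

/-- Numerical margin: for `0 ≤ ρ < 1/√2`, `5/16 - ½ √(5/16) (√2 ρ) > 1/40`
(`√(5/16)·√2·(√2/2) = √5/4 < 0.56`, i.e. `√5/8 < 5/16`). [folklore] -/
theorem dls_margin_pos {ρ : ℝ} (hρ0 : 0 ≤ ρ) (hρ : ρ < Real.sqrt 2 / 2) :
    1 / 40 < 5 / 16 - 1 / 2 * Real.sqrt (5 / 16) * (Real.sqrt 2 * ρ) := by
  have h1 : Real.sqrt (5 / 16) < 0.5591 := by
    rw [Real.sqrt_lt' (by norm_num)]; norm_num
  have h2 : Real.sqrt 2 < 1.4143 := by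
    rw [Real.sqrt_lt' (by norm_num)]; norm_num
  have h3 : ρ < 0.70715 := by linarith
  have h4 : 0 ≤ Real.sqrt (5 / 16) := Real.sqrt_nonneg _
  have h5 : 0 ≤ Real.sqrt 2 := Real.sqrt_nonneg _
  have h12 : Real.sqrt (5 / 16) * Real.sqrt 2 ≤ 0.5591 * 1.4143 :=
    mul_le_mul h1.le h2.le h5 (by norm_num)
  have h123 : Real.sqrt (5 / 16) * Real.sqrt 2 * ρ ≤ 0.5591 * 1.4143 * 0.70715 :=
    mul_le_mul h12 h3.le hρ0 (by norm_num)
  nlinarith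

/-- **Dyson–Lieb–Simon (1978), Theorem 6.2 — discharge of `dyson_lieb_simon`.** For the spin-`S`
Heisenberg antiferromagnet `J Σ_{⟨xy⟩} 𝐒_x·𝐒_y`, `J > 0`, on the even tori `(ℤ/2kℤ)^d` with
`d ≥ 3` and `S = n/2 ≥ 1`, there is `β₀ > 0` such that for all `β ≥ β₀` the Gibbs states have
Néel long-range order, `liminf_k |Λ|⁻²Σ_{x,y}(-1)^{x+y}⟨𝐒_x·𝐒_y⟩_{β,2k} > 0`
(`HasStaggeredEvenTorusLRO`). Proof: reflection positivity and Gaussian domination for the rotated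
model at positive temperature (`dls_partitionFn_field_le`), the infrared bound for the Duhamel
two-point function and the Falk–Bruch transfer (`dls_infraredBound`), the sum rule in the
Kennedy–Lieb–Shastry form (`dls_ineq`), the `SU(2)` symmetry and the Néel-state energy bound
(`gibbsBondCorr_dls_eq`, `dls_bondCorr_energy_bound`), the certified bound
`limsup R_L < 1/√2` on the KLS lattice sums (`klsRiemannSum_eventually_le`) and the finiteness of
the lattice Green function in `d ≥ 3` (`torusGreen_zero_eventually_le`); quantitatively,
eventually in `L = 2k`, `|Λ|⁻²Σ(-1)^{x+y}⟨𝐒_x·𝐒_y⟩ ≥ 3[5/16 - ½√(5/16)·√2ρ - T_L/(2βJ)] > 3/80`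
once `log(n+1)/(dβJ) ≤ 1/16` and `T_L/(2βJ) ≤ 1/80`.
[cite: DLS1978, Thm. 6.2] [cite: Tasaki2020, §4.4] -/
theorem dyson_lieb_simon_holds : dyson_lieb_simon := by
  intro d hd n hn J hJ
  have hd1 : 1 ≤ d := by omega
  have hd0 : (0 : ℝ) < d := by exact_mod_cast (show 0 < d by omega)
  -- the eventual bound on the KLS Riemann sums
  obtain ⟨ρ, hρlt, hρev⟩ := klsRiemannSum_eventually_le d (by omega)
  set ρ' : ℝ := max ρ 0 with hρ'_def
  have hρ'0 : 0 ≤ ρ' := le_max_right _ _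
  have hρ'lt : ρ' < Real.sqrt 2 / 2 := max_lt hρlt (by positivity)
  have h2pos : (0 : ℝ) < Real.sqrt 2 := by positivity
  have h22 : Real.sqrt 2 * Real.sqrt 2 = 2 := Real.mul_self_sqrt (by norm_num)
  have hρ'1 : Real.sqrt 2 * ρ' < 1 := by nlinarith
  -- the margin
  set m₁ : ℝ := 5 / 16 - 1 / 2 * Real.sqrt (5 / 16) * (Real.sqrt 2 * ρ') with hm₁_def
  have hm₁ : 1 / 40 < m₁ := dls_margin_pos hρ'0 hρ'lt
  -- the thermal term `T_L`
  obtain ⟨𝒯, k₀, h𝒯0, h𝒯⟩ := torusGreen_zero_eventually_le (d := d) hd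
  -- the threshold `β₀`
  set ℓ : ℝ := Real.log (n + 1) / d with hℓ_def
  have hℓ0 : 0 ≤ ℓ := by
    rw [hℓ_def]
    exact div_nonneg (Real.log_nonneg (by norm_cast; omega)) hd0.le
  set β₀ : ℝ := (16 * ℓ + 40 * 𝒯 + 1) / J with hβ₀_def
  have hβ₀pos : 0 < β₀ := by rw [hβ₀_def]; positivity
  refine ⟨β₀, hβ₀pos, fun β hβ => ?_⟩
  have hβpos : 0 < β := hβ₀pos.trans_le hβ
  -- `β' = βJ`
  set β' : ℝ := β * J with hβ'_def
  have hβ'pos : 0 < β' := mul_pos hβpos hJ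
  have hβ'ge : 16 * ℓ + 40 * 𝒯 + 1 ≤ β' := by
    rw [hβ'_def]
    have := (div_le_iff₀ hJ).1 hβ
    linarith
  have hℓβ : ℓ / β' ≤ 1 / 16 := by
    rw [div_le_iff₀ hβ'pos]; nlinarith
  have h𝒯β : 𝒯 / (2 * β') ≤ 1 / 80 := by
    rw [div_le_iff₀ (by positivity)]; nlinarith
  -- spin `S² ≥ 1`
  have hS2 : (1 : ℝ) ≤ ((n : ℝ) / 2) ^ 2 := by
    have : (2 : ℝ) ≤ n := by exact_mod_cast hn
    nlinarith
  rw [HasStaggeredEvenTorusLRO, HasStaggeredLongRangeOrder, HasLongRangeOrder]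
  -- eventually `R_{2k} ≤ ρ'`
  have h2k : Tendsto (fun k : ℕ => 2 * k) atTop atTop :=
    tendsto_atTop_atTop.2 fun b => ⟨b, fun k hk => by omega⟩
  have hRk : ∀ᶠ k : ℕ in atTop, klsRiemannSum d (2 * k) ≤ ρ' :=
    (h2k.eventually hρev).mono fun k hk => hk.trans (le_max_left _ _)
  -- eventually the order parameter is `≥ 3/80`
  have hev : ∀ᶠ k : ℕ in atTop, 3 * (1 / 80 : ℝ) ≤
      (∑ x ∈ halfOpenBox d (2 * k), ∑ y ∈ halfOpenBox d (2 * k),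
          latticeStagger x * latticeStagger y *
            torusPullback (fun L x y => spinSpinCorrTorus (d := d) β L n J x y) (2 * k) x y) /
        ((halfOpenBox d (2 * k)).card : ℝ) ^ 2 := by
    filter_upwards [hRk, eventually_ge_atTop 2, eventually_ge_atTop k₀] with k hk hk2 hkk₀
    haveI : NeZero (2 * k) := ⟨by omega⟩
    rw [staggeredSum_torusPullback_of_neZero, dls_orderParameter_eq]
    set X := dlsHamiltonian d (2 * k) n with hX
    set e₀ := gibbsBondCorr β' X 0 with he₀
    set e₁ := gibbsBondCorr β' X 1 with he₁
    set e₂ := gibbsBondCorr β' X 2 with he₂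
    set g₀ := gibbsStructureFactor β' X 0 (0 : TorusSite d (2 * k)) / ((2 * k : ℕ) : ℝ) ^ d
      with hg₀
    set R := klsRiemannSum d (2 * k) with hR_def
    set T := torusGreen (0 : TorusSite d (2 * k)) with hT_def
    have hR0 : 0 ≤ R := klsRiemannSum_nonneg _ _
    have hT0 : 0 ≤ T := torusGreen_zero_nonneg (d := d) (2 * k)
    have hT𝒯 : T ≤ 𝒯 := h𝒯 k hkk₀ (by omega)
    -- (SYM): `e₀ = ε`, `e₁ = -ε`, `e₂ = ε`
    obtain ⟨hE0, hE1, hE2⟩ := gibbsBondCorr_dls_eq (d := d) β k n J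
    rw [← hβ'_def, ← hX] at hE0 hE1 hE2
    set ε : ℝ := -gibbsBondCorr β (heisenbergTorus d (2 * k) n J) 0 with hε
    have hε0 : e₀ = ε := by rw [he₀, hE0]
    have hε1 : e₁ = -ε := by rw [he₁, hE1, hε, neg_neg]
    have hε2 : e₂ = ε := by rw [he₂, hE2]
    -- (EN): `3ε ≥ S² - ℓ/β'`
    have hEN := dls_bondCorr_energy_bound (2 * k) n hd1 (by omega) hβ'pos
    rw [← hX, ← he₀, ← he₁, ← he₂, hε0, hε1, hε2] at hEN
    have hℓβ' : Real.log (n + 1) / (d * β') = ℓ / β' := by rw [hℓ_def, div_div]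
    rw [hℓβ'] at hEN
    -- so `ε ≥ 5/16`
    have hε516 : 5 / 16 ≤ ε := by linarith
    have hεpos : 0 ≤ ε := by linarith
    -- (KLS): `ε ≤ g₀ + ½√(2ε) R + T/(2β')`
    have ht : 0 ≤ e₂ - e₁ := by rw [hε1, hε2]; linarith
    have h7 := dls_ineq n hd1 hk2 hβ'pos ht
    rw [← hX, ← he₀, ← he₁, ← he₂, ← hg₀, ← hR_def, ← hT_def, hε0, hε1, hε2,
      show ε - -ε = 2 * ε by ring] at h7
    -- the monotone step on `t ↦ t - ½ √t (√2 R)` from `5/16` to `ε`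
    have hsqrt2ε : Real.sqrt (2 * ε) = Real.sqrt ε * Real.sqrt 2 := by
      rw [mul_comm, Real.sqrt_mul hεpos]
    have hR4 : Real.sqrt 2 * R ≤ 4 * Real.sqrt (5 / 16) := by
      have h14 : (1 / 2 : ℝ) ≤ Real.sqrt (5 / 16) := by
        rw [Real.le_sqrt (by norm_num) (by norm_num)]; norm_num
      have : Real.sqrt 2 * R ≤ Real.sqrt 2 * ρ' := mul_le_mul_of_nonneg_left hk h2pos.le
      linarith
    have hmono := kls_monotone_step (s := 5 / 16) (e := ε) (R := Real.sqrt 2 * R) (by norm_num)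
      hε516 hR4
    -- `½ √(5/16) (√2 R) ≤ ½ √(5/16) (√2 ρ')`
    have hRρ : 1 / 2 * Real.sqrt (5 / 16) * (Real.sqrt 2 * R) ≤
        1 / 2 * Real.sqrt (5 / 16) * (Real.sqrt 2 * ρ') :=
      mul_le_mul_of_nonneg_left (mul_le_mul_of_nonneg_left hk h2pos.le) (by positivity)
    -- the thermal term
    have hTβ : 1 / (2 * β') * T ≤ 𝒯 / (2 * β') := by
      rw [one_div_mul_eq_div]
      exact div_le_div_of_nonneg_right hT𝒯 (by positivity)
    -- assemble
    have key : ε - 1 / 2 * Real.sqrt ε * (Real.sqrt 2 * R) - 1 / (2 * β') * T ≤ g₀ := by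
      have : 1 / 2 * Real.sqrt (2 * ε) * R = 1 / 2 * Real.sqrt ε * (Real.sqrt 2 * R) := by
        rw [hsqrt2ε]; ring
      linarith [h7]
    linarith [key, hmono, hRρ, hTβ, h𝒯β, hm₁, hm₁_def]
  refine lt_of_lt_of_le (by norm_num : (0 : ℝ) < 3 * (1 / 80)) ?_
  exact le_liminf_of_le (isCoboundedUnder_ge_of_le atTop fun k => dls_orderParameter_le β n J hd1 k) hev

end Main

end Literature.MathematicalPhysics.QuantumLattice
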